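import Mathlib
import HarnessLib
import Summits.ResolutionOfSingularities.ResolutionOfSingularities.Theorems.WildQuotientsWildQuotientResolutionS1aKillPowerChains
import Summits.ResolutionOfSingularities.ResolutionOfSingularities.Theorems.WildQuotientsWildQuotientResolutionS1aTriangularKillsIn

/-!
# S1a — TRIANGULAR ROOT KILLS WITH SHIFT: (T1δ)–(T3δ) data are killed by ONE move; trA, k2a, a1c2, d4c3 are ONE-SHOT (every prime `p`)

[OURS · L1 W4.5c · lead-1 g14; `…S1aTriangularKillsIn` ✓p701978 generalised along KC3_δ ✓p639579 / KC5_δ (`…S1aKillPowerChains`): the shift `δ` and POWERS of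
the centre generators in the chains] — NOT statements of the manuscript; counted 0; AI-level work, weaker than expert review. Crux
stmt-ResolutionOfSingularities-17941 `CyclicQuotientFourfolds`, line `s1a-logminvertex` v13 (`stub_reachLowerInFX`). A FAMILY OF RUNGS of the research stub, not the stub.

THE DATUM (any finite variable type `ι`): `e : Γ(X′, ⊤) ≃ k[x_ι]` intertwining `g₀` with `σ` fixing constants; distinct centre variables `v : Fin c ↪ ι` with
positive weights `w`, a shift `δ`; (T1δ) `σxᵢ − xᵢ ∈ 𝒥_δ` for all `i`, `σx_{v l} − x_{v l} ∈ 𝒥_{w l+δ}`; (T2) `(x_{v l})^N ≤ augIdeal σ`; (T3δ) POWER CHAINS: for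
every `l` some `m ≥ 1` with `δ ≤ m·w l`, `u ∈ 𝒥_{m w l − δ}`, unit `h` with `σu − u − h x_{v l}^m ∈ 𝒥_{m w l + 1}`. Then `KillsIn 1 (GModel.initial hq h₀)` —
`X′` itself is a principal-centre chart for the certificate `s^δ`.
FINDING (OURS): the census germs that X-CERT v1.3-SMALLP (engine `wmax = 2`, `δ ≤ 1`) resolved in 2–3 moves are ONE-SHOT ROOT KILLS with higher weights and
shift: ★ `trA_killsIn_one` (σ: x₁↦x₁+x₀², x₂↦x₂+x₀³, x₃↦x₃+x₂; centre (x₀:2, x₂:3), δ = 3, chains `x₀³ = σx₂ − x₂`, `x₂ = σx₃ − x₃`), ★ `k2a_killsIn_one`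
(σ: x₁↦x₁+x₀, x₃↦x₃+x₁(x₁+x₀); centre (x₀:3, x₁:1), δ = 2, `x₁² ≡ σx₃ − x₃ mod 𝒥₃`), ★ `a1c2_killsIn_one` (also x₂↦x₂+x₀; same centre),
★ `d4c3z_killsIn_one` (σ in the coordinates `z = x₁ − x₂`: x₀, z fixed, x₂↦x₂+x₀, x₃↦x₃+z³; centre (x₀:3, z:1), δ = 3) and ★ `d4c3_killsIn_one` (the printed
coordinates x₁↦x₁+x₀, x₂↦x₂+x₀, x₃↦x₃+(x₁−x₂)³, through the linear recoordination `x₁ ↦ x₁ − x₂` absorbed into `e`). Only a1 and D₄ of the census remain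
multi-shot (reducible fixed locus: isolation fails for every smooth centre).
-/

set_option linter.dupNamespace false

noncomputable section

open CategoryTheory Limits AlgebraicGeometry TopologicalSpace Topology Opposite MvPolynomial
open Literature.AlgebraicGeometry.Resolution Literature.AlgebraicGeometry.RelativeSpec
open Summit.ResolutionOfSingularities.ResolutionOfSingularities.Theorems.WildQuotientResolution.S1
open Summit.ResolutionOfSingularities.ResolutionOfSingularities.Theorems.WildQuotientResolution.S1.NodeAtlas
open Summit.ResolutionOfSingularities.ResolutionOfSingularities.Theorems.WildQuotientResolution.S1.KillCert
open Summit.ResolutionOfSingularities.ResolutionOfSingularities.Theorems.WildQuotientResolution.S1.GoodCharts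
open Summit.ResolutionOfSingularities.ResolutionOfSingularities.Theorems.WildQuotientResolution.S1.NpFrame

namespace Summit.ResolutionOfSingularities.ResolutionOfSingularities.Theorems.WildQuotientResolution.S1.GameFrame.GModel

open KillCert

variable {p : ℕ} {X' X₁ : Scheme.{0}} {q : X' ⟶ X₁} {G : Type} [Group G] {ρ : G →* Aut X'} {g₀ : G}

/-- Powers of a centre generator: `u i ^ m ∈ 𝒥_{m·w i}`. [folklore] -/
theorem pow_mem_weightedFiltration_ideal {R : Type*} [CommRing R] {c : ℕ} (u : Fin c → R) (w : Fin c → ℕ) (i : Fin c) (m : ℕ) :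
    u i ^ m ∈ (weightedFiltration u w).ideal (m * w i) := by
  induction m with
  | zero => rw [pow_zero, zero_mul, (weightedFiltration u w).ideal_zero]; trivial
  | succ m ih =>
    have := (weightedFiltration u w).mul_le _ _ (Ideal.mul_mem_mul ih (mem_weightedFiltration_ideal u w i))
    rwa [← pow_succ, show m * w i + w i = (m + 1) * w i by ring] at this

/-- Isolation from radical membership: if every centre variable has a power in `augIdeal σ` then `(x_v)^N ≤ augIdeal σ` for some `N`. [folklore] -/
theorem exists_span_pow_le_of_pow_mem {R : Type*} [CommRing R] {c : ℕ} (u : Fin c → R) (I : Ideal R) (h : ∀ l, ∃ n : ℕ, u l ^ n ∈ I) :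
    ∃ N : ℕ, Ideal.span (Set.range u) ^ N ≤ I := by
  refine Ideal.exists_pow_le_of_le_radical_of_fg ?_ (Submodule.fg_span (Set.finite_range _))
  rw [Ideal.span_le]
  rintro _ ⟨l, rfl⟩
  exact h l

/-- ★★★ **A TRIANGULAR DATUM IS KILLED BY ONE MOVE OF THE GAME (all `p`, any number of variables).** Let `(X′, X₁, q, ρ, g₀)` be action data with `X′`
AFFINE, regular, locally Noetherian and separated, `X₁` separated, `q` affine and `G`-invariant, `G` finite, `g₀ ^ p = 1`, and let
`e : Γ(X′, ⊤) ≃+* k[x_ι]` intertwine the action of `g₀` on global sections with a ring automorphism `σ` fixing constants. Let distinct variables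
`x_{v l}` (`c > 0` of them) with positive weights `w` satisfy (T1δ) rows, (T2) isolation and (T3δ) power chains (module docstring). Then on the INITIAL MODEL the
weighted centre `(e⁻¹x_{v l}; w)` IS a legal PRINCIPAL (kill) move: `∃ 𝒦 d, IsPrincipalCentre p _ g₀ 𝒦 d` whose filtration on `X′` is `𝒥ₙ((e⁻¹x_{v l}), w)`,
whose support is EXACTLY `V(e⁻¹x_{v l})`, and for which every stable affine chart with underlying open `⊤` (i.e. `X′`) is a principal-centre chart.
[OURS · L1 W4.5c · one-shot class with shift; NOT a statement of the manuscript] -/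
theorem exists_isPrincipalCentre_initial_of_triangularShift [Finite G] (hp : 0 < p) (hG : ∀ g : G, g ∈ Subgroup.zpowers g₀) (hg₀ : g₀ ^ p = 1)
    (hq : ∀ g : G, (ρ g).hom ≫ q = q) [IsIntegral X'] [IsLocallyNoetherian X'] [X'.IsSeparated] [IsAffine X'] [X₁.IsSeparated] [IsAffineHom q]
    (hreg : Scheme.IsRegular X') {k : Type} [Field k] {ι : Type} [Fintype ι] [DecidableEq ι] (σ : MvPolynomial ι k ≃+* MvPolynomial ι k) (hC : ∀ a : k, σ (C a) = C a)
    {c : ℕ} (hc : 0 < c) (v : Fin c → ι) (hv : Function.Injective v) (w : Fin c → ℕ) (hw : ∀ l, 0 < w l) (δ : ℕ)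
    (hrow : ∀ i : ι, σ (X i) - X i ∈ (weightedFiltration (X ∘ v : Fin c → MvPolynomial ι k) w).ideal δ)
    (hrowc : ∀ l : Fin c, σ (X (v l)) - X (v l) ∈ (weightedFiltration (X ∘ v : Fin c → MvPolynomial ι k) w).ideal (w l + δ))
    (hiso : ∃ N : ℕ, Ideal.span (Set.range (X ∘ v : Fin c → MvPolynomial ι k)) ^ N ≤ augmentationIdeal σ)
    (hchain : ∀ l : Fin c, ∃ (m : ℕ) (u h : MvPolynomial ι k), 0 < m ∧ δ ≤ m * w l ∧ IsUnit h ∧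
      u ∈ (weightedFiltration (X ∘ v : Fin c → MvPolynomial ι k) w).ideal (m * w l - δ) ∧
      σ u - u - h * X (v l) ^ m ∈ (weightedFiltration (X ∘ v : Fin c → MvPolynomial ι k) w).ideal (m * w l + 1))
    (e : Γ(X', ⊤) ≃+* MvPolynomial ι k)
    (hστ : ∀ t : Γ(X', ⊤), e ((ρ g₀⁻¹).hom.appLE ⊤ ⊤ (by rw [Scheme.Hom.preimage_top]) t) = σ (e t)) :
    letI h₀ : NodeAtlas p (⟨ρ, hq⟩ : ActionOver q G) g₀ := stub_initialAtlas p hp q G ρ g₀ hg₀ hq hreg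
    ∃ (𝒦 : ReesFiltration X') (d : ℕ), IsPrincipalCentre p (GModel.initial hq h₀).act g₀ 𝒦 d ∧
      (∀ n, (𝒦.filtration ⟨⊤, isAffineOpen_top X'⟩).ideal n = (weightedFiltration (fun l => e.symm (X (v l))) w).ideal n) ∧
      (((𝒦.ideal d).support : Set X')) = X'.zeroLocus (U := ⊤) (Set.range fun l => e.symm (X (v l))) ∧
      ∀ O : (GModel.initial hq h₀).act.StableAffineOpens, O.1 = ⊤ → IsPrincipalCentreChart p (GModel.initial hq h₀).act g₀ 𝒦 d O := by
  classical
  -- the one chart: all of `X′`, affine over `X₁`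
  haveI : IsAffine (⊤ : X'.Opens) := isAffineOpen_top X'
  have hAff : IsAffineHom ((⊤ : X'.Opens).ι ≫ q) := inferInstance
  have hst : ∀ g : G, (ρ g).hom ⁻¹ᵁ (⊤ : X'.Opens) = ⊤ := fun g => Scheme.Hom.preimage_top _
  let O : (⟨ρ, hq⟩ : ActionOver q G).StableAffineOpens := ⟨⊤, hst, hAff⟩
  have hO : IsAffineOpen O.1 := isAffineOpen_top X'
  haveI hsep : (GModel.initial hq (stub_initialAtlas p hp q G ρ g₀ hg₀ hq hreg) : GModel p q G ρ g₀).V.IsSeparated := ‹X'.IsSeparated›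
  -- the frame in `A = Γ(X′, ⊤)` and the automorphism `τ = g₀` acting on it
  let A := Γ(X', (⊤ : X'.Opens))
  let τ : A ≃+* A := actOEquiv (⟨ρ, hq⟩ : ActionOver q G) O g₀
  let ε : MvPolynomial ι k →+* A := (e.symm : MvPolynomial ι k →+* A)
  let f : Fin c → A := fun l => e.symm (X (v l))
  have hact : ∀ t : A, τ t = e.symm (σ (e t)) := fun t => by
    apply e.injective
    rw [e.apply_symm_apply, ← hστ]
    rfl
  have hactX : ∀ y, τ (e.symm y) = e.symm (σ y) := fun y => by rw [hact, e.apply_symm_apply]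
  have hinc : ∀ y, τ (e.symm y) - e.symm y = e.symm (σ y - y) := fun y => by rw [hactX, map_sub]
  -- transport of the weighted filtration along `e⁻¹`
  have hJ : ∀ n, ((weightedFiltration (X ∘ v : Fin c → MvPolynomial ι k) w).ideal n).map ε = (weightedFiltration f w).ideal n :=
    fun n => Literature.AlgebraicGeometry.Resolution.map_weightedFiltration_ideal _ w ε n
  have hmemJ : ∀ {n : ℕ} {y : MvPolynomial ι k}, y ∈ (weightedFiltration (X ∘ v : Fin c → MvPolynomial ι k) w).ideal n →
      e.symm y ∈ (weightedFiltration f w).ideal n := fun {n} {y} hy => by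
    rw [← hJ n]
    exact Ideal.mem_map_of_mem ε hy
  have h1J : ∀ {n : ℕ} {y : A}, y ∈ (weightedFiltration f w).ideal n → y ∈ Ideal.span {(1 : A)} * (weightedFiltration f w).ideal n :=
    fun hy => by rw [Ideal.span_singleton_one, Ideal.top_mul]; exact hy
  -- (a′): `τ` moves `𝒥ₙ` within `𝒥ₙ₊₁` — checked on the generators `e⁻¹(C a)`, `e⁻¹(xᵢ)` of `A`
  have hgen : Subring.closure (e.symm '' (Set.range (C : k → MvPolynomial ι k) ∪ Set.range (X : ι → MvPolynomial ι k))) = ⊤ := by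
    show Subring.closure (ε '' _) = ⊤
    rw [← RingHom.map_closure, closure_range_C_union_range_X_of k ι, ← RingHom.range_eq_map]
    exact RingHom.range_eq_top.mpr e.symm.surjective
  have hadm : ∀ (n : ℕ) (y : A), y ∈ (weightedFiltration f w).ideal n →
      τ y - y ∈ Ideal.span {(1 : A)} * (weightedFiltration f w).ideal (n + δ) := by
    refine admissible_shift_of_generators f w τ δ 1 _ hgen ?_ ?_
    · rintro _ ⟨g, hg | hg, rfl⟩
      · obtain ⟨a, rfl⟩ := hg
        rw [hactX, hC, sub_self]; exact Ideal.zero_mem _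
      · obtain ⟨i, rfl⟩ := hg
        rw [hinc]; exact h1J (hmemJ (hrow i))
    · intro l
      change τ (e.symm (X (v l))) - e.symm (X (v l)) ∈ _
      rw [hinc]; exact h1J (hmemJ (hrowc l))
  have hσJ : ∀ n : ℕ, ((weightedFiltration f w).ideal n).map (τ : A →+* A) ≤ (weightedFiltration f w).ideal n :=
    map_le_of_admissible_shift f w τ δ 1 hadm
  -- (ii): isolation, transported
  have haug : (augmentationIdeal σ).map ε ≤ augmentationIdeal τ := by
    rw [augmentationIdeal, Ideal.map_span, Ideal.span_le]
    rintro _ ⟨_, ⟨b, rfl⟩, rfl⟩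
    change e.symm (σ b - b) ∈ augmentationIdeal τ
    rw [← hinc]
    exact sub_mem_augmentationIdeal τ _
  have hspan : Ideal.span (Set.range f) = (Ideal.span (Set.range (X ∘ v : Fin c → MvPolynomial ι k))).map ε := by
    rw [Ideal.map_span, ← Set.range_comp]
    rfl
  have hiso' : ∃ N : ℕ, Ideal.span (Set.range f) ^ N ≤ (augmentationIdeal τ).colon (Ideal.span {(1 : A)}) := by
    obtain ⟨N, hN⟩ := hiso
    refine ⟨N, fun x hx => ?_⟩
    rw [Ideal.mem_colon_span_singleton, mul_one]
    rw [hspan, ← Ideal.map_pow] at hx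
    exact haug (Ideal.map_mono hN hx)
  -- the power-chain certificate `g = s^δ` (KC3_δ ∘ KC5_δ with `β = 1`)
  have hchain' : ∀ l, ∃ (m : ℕ) (u h : A), 0 < m ∧ δ ≤ m * w l ∧ IsUnit h ∧ u ∈ (weightedFiltration f w).ideal (m * w l - δ) ∧
      τ u - u - 1 * h * f l ^ m ∈ Ideal.span {(1 : A)} * (weightedFiltration f w).ideal (m * w l + 1) := by
    intro l
    obtain ⟨m, u, h, hm, hmδ, hh, hu, hrowu⟩ := hchain l
    refine ⟨m, e.symm u, e.symm h, hm, hmδ, hh.map e.symm, hmemJ hu, h1J ?_⟩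
    have e1 : τ (e.symm u) - e.symm u - 1 * e.symm h * f l ^ m = e.symm (σ u - u - h * X (v l) ^ m) := by
      rw [hinc, one_mul, map_sub e.symm (σ u - u), map_mul, map_pow]
    rw [e1]
    exact hmemJ hrowu
  have hcert : ∀ (hp' : 0 < p) (hσp : ∀ x, (⇑τ)^[p] x = x), ∃ g, CobordantKillCert f w τ hσJ hp' hσp g := fun hp' hσp =>
    ⟨_, cobordantKillCert_of_powerChains_shift f w τ hσJ hp' hσp δ 1 hadm hiso' hchain'⟩
  -- K1′ in `A`, transported from `k[x]`
  have hK1 : RingTheory.Sequence.IsRegular A (List.ofFn f) :=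
    IsRegular.of_ringEquiv_ofFn e.symm (X ∘ v) (isRegular_X_comp k v hv)
  have hK1' : IsRegularRing (A ⧸ Ideal.span (Set.range f)) :=
    isRegularRing_quotient_of_ringEquiv e.symm (X ∘ v) (isRegularRing_quotient_X_comp k v)
  -- the cover theorem with the single chart `X′`
  obtain ⟨𝒦, d, hprin, hsupp, hchart, hfil, hZ⟩ := exists_isPrincipalCentre_filtration_eq_of_certCover (ι := Fin 1) hG hg₀
    (GModel.initial hq (stub_initialAtlas p hp q G ρ g₀ hg₀ hq hreg)) hreg (fun _ => O) (fun _ => hO)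
    (fun _ => c) (fun _ => f) (fun _ => w) (fun _ => hc) (fun _ l => hw l) (fun _ => hK1) (fun _ => hK1')
    (fun _ => hσJ) (fun _ => hcert) (fun _ _ _ _ _ _ => rfl)
    (B := X'.zeroLocus (U := ⊤) (Set.range f)) (X'.zeroLocus_isClosed _)
    (fun x _ => Set.mem_iUnion.mpr ⟨0, trivial⟩) (fun _ => Set.inter_subset_left)
  refine ⟨𝒦, d, hprin, hfil 0, le_antisymm hsupp fun x hx => hZ 0 ⟨hx, trivial⟩, fun O' hO' => ?_⟩
  obtain rfl : O' = O := Subtype.ext hO'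
  exact hchart 0

/-- ★★★ **`KillsIn 1` FOR THE INITIAL MODEL OF A TRIANGULAR DATUM** (any `p`, any number of variables; `q` finite, `X₁ → Spec k′` locally of finite type):
ONE admissible move — the weighted blow-up of the centre variables, `X′` itself a principal-centre chart — all of whose realisations carry a node atlas with
EMPTY formal locus. [OURS · L1 W4.5c · one-shot class with shift; NOT a statement of the manuscript] -/
theorem triangularShift_killsIn_one [Finite G] (hp : p.Prime) (hG : ∀ g : G, g ∈ Subgroup.zpowers g₀) (hg₀ : g₀ ^ p = 1)
    (hq : ∀ g : G, (ρ g).hom ≫ q = q) [IsIntegral X'] [IsLocallyNoetherian X'] [X'.IsSeparated] [IsAffine X'] [X₁.IsSeparated] [IsFinite q]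
    (hreg : Scheme.IsRegular X') {k' : Type} [Field k'] (φ : X₁ ⟶ Spec (.of k')) [LocallyOfFiniteType φ]
    {k : Type} [Field k] {ι : Type} [Fintype ι] [DecidableEq ι] (σ : MvPolynomial ι k ≃+* MvPolynomial ι k) (hC : ∀ a : k, σ (C a) = C a)
    {c : ℕ} (hc : 0 < c) (v : Fin c → ι) (hv : Function.Injective v) (w : Fin c → ℕ) (hw : ∀ l, 0 < w l) (δ : ℕ)
    (hrow : ∀ i : ι, σ (X i) - X i ∈ (weightedFiltration (X ∘ v : Fin c → MvPolynomial ι k) w).ideal δ)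
    (hrowc : ∀ l : Fin c, σ (X (v l)) - X (v l) ∈ (weightedFiltration (X ∘ v : Fin c → MvPolynomial ι k) w).ideal (w l + δ))
    (hiso : ∃ N : ℕ, Ideal.span (Set.range (X ∘ v : Fin c → MvPolynomial ι k)) ^ N ≤ augmentationIdeal σ)
    (hchain : ∀ l : Fin c, ∃ (m : ℕ) (u h : MvPolynomial ι k), 0 < m ∧ δ ≤ m * w l ∧ IsUnit h ∧
      u ∈ (weightedFiltration (X ∘ v : Fin c → MvPolynomial ι k) w).ideal (m * w l - δ) ∧
      σ u - u - h * X (v l) ^ m ∈ (weightedFiltration (X ∘ v : Fin c → MvPolynomial ι k) w).ideal (m * w l + 1))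
    (e : Γ(X', ⊤) ≃+* MvPolynomial ι k)
    (hστ : ∀ t : Γ(X', ⊤), e ((ρ g₀⁻¹).hom.appLE ⊤ ⊤ (by rw [Scheme.Hom.preimage_top]) t) = σ (e t))
    (h₀ : NodeAtlas p (⟨ρ, hq⟩ : ActionOver q G) g₀) :
    KillsIn 1 (GModel.initial (p := p) (g₀ := g₀) hq h₀) := by
  obtain ⟨𝒦, d, hprin, -, -, hchart⟩ :=
    exists_isPrincipalCentre_initial_of_triangularShift (p := p) hp.pos hG hg₀ hq hreg σ hC hc v hv w hw δ hrow hrowc hiso hchain e hστ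
  haveI : IsAffine (⊤ : X'.Opens) := isAffineOpen_top X'
  have hAff : IsAffineHom ((⊤ : X'.Opens).ι ≫ q) := inferInstance
  have hst : ∀ g : G, (ρ g).hom ⁻¹ᵁ (⊤ : X'.Opens) = ⊤ := fun g => Scheme.Hom.preimage_top _
  let O : (GModel.initial (p := p) (g₀ := g₀) hq h₀).act.StableAffineOpens := ⟨⊤, hst, hAff⟩
  exact killsIn_one_of_principalCentreChart_top hp hG (GModel.initial hq h₀) (hasNoetherianBase_of_datum φ _)
    ⟨NodeAtlasData.ofNodeAtlas (p := p) (ρ := (⟨ρ, hq⟩ : ActionOver q G)) (g₀ := g₀) h₀⟩ 𝒦 d hprin O rfl (hchart O rfl)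

/-- ★★★ **A TRIANGULAR DATUM satisfies the conclusion of `ReachLowerInF(X)`** at its initial model with ANY root decoration `𝔄₀`
(`exists_reachLowerF_of_killsIn_datum` on `triangularShift_killsIn_one`). [OURS · L1 W4.5c · one-shot class with shift; NOT a statement of the manuscript] -/
theorem exists_reachLowerF_initial_of_triangularShift [Finite G] (hp : p.Prime) (hG : ∀ g : G, g ∈ Subgroup.zpowers g₀) (hg₀ : g₀ ^ p = 1)
    (hq : ∀ g : G, (ρ g).hom ≫ q = q) [IsIntegral X'] [IsLocallyNoetherian X'] [X'.IsSeparated] [IsAffine X'] [X₁.IsSeparated] [IsFinite q]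
    (hreg : Scheme.IsRegular X') {k' : Type} [Field k'] (φ : X₁ ⟶ Spec (.of k')) [LocallyOfFiniteType φ]
    {k : Type} [Field k] {ι : Type} [Fintype ι] [DecidableEq ι] (σ : MvPolynomial ι k ≃+* MvPolynomial ι k) (hC : ∀ a : k, σ (C a) = C a)
    {c : ℕ} (hc : 0 < c) (v : Fin c → ι) (hv : Function.Injective v) (w : Fin c → ℕ) (hw : ∀ l, 0 < w l) (δ : ℕ)
    (hrow : ∀ i : ι, σ (X i) - X i ∈ (weightedFiltration (X ∘ v : Fin c → MvPolynomial ι k) w).ideal δ)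
    (hrowc : ∀ l : Fin c, σ (X (v l)) - X (v l) ∈ (weightedFiltration (X ∘ v : Fin c → MvPolynomial ι k) w).ideal (w l + δ))
    (hiso : ∃ N : ℕ, Ideal.span (Set.range (X ∘ v : Fin c → MvPolynomial ι k)) ^ N ≤ augmentationIdeal σ)
    (hchain : ∀ l : Fin c, ∃ (m : ℕ) (u h : MvPolynomial ι k), 0 < m ∧ δ ≤ m * w l ∧ IsUnit h ∧
      u ∈ (weightedFiltration (X ∘ v : Fin c → MvPolynomial ι k) w).ideal (m * w l - δ) ∧
      σ u - u - h * X (v l) ^ m ∈ (weightedFiltration (X ∘ v : Fin c → MvPolynomial ι k) w).ideal (m * w l + 1))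
    (e : Γ(X', ⊤) ≃+* MvPolynomial ι k)
    (hστ : ∀ t : Γ(X', ⊤), e ((ρ g₀⁻¹).hom.appLE ⊤ ⊤ (by rw [Scheme.Hom.preimage_top]) t) = σ (e t))
    (h₀ : NodeAtlas p (⟨ρ, hq⟩ : ActionOver q G) g₀) (𝔄₀ : NodeAtlasData p (GModel.initial hq h₀).act g₀) :
    ∃ P : ∀ M : GModel p q G ρ g₀, NodeAtlasData p M.act g₀ → Prop,
      P (GModel.initial hq h₀) 𝔄₀ ∧ ∀ (M : GModel p q G ρ g₀) (𝔄 : NodeAtlasData p M.act g₀), P M 𝔄 → ¬ M.Terminal →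
        ∃ n : ℕ, TreeF P (fun N 𝔅 => LexLTF N 𝔅 M 𝔄) n M 𝔄 :=
  exists_reachLowerF_of_killsIn_datum hp hG φ (GModel.initial hq h₀) 𝔄₀
    (triangularShift_killsIn_one hp hG hg₀ hq hreg φ σ hC hc v hv w hw δ hrow hrowc hiso hchain e hστ h₀)


end Summit.ResolutionOfSingularities.ResolutionOfSingularities.Theorems.WildQuotientResolution.S1.GameFrame.GModel

end
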